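import Mathlib
import HarnessLib
import Summits.Ventures.LatticeQCDFlow.Scaling.PlaquetteIndependence2D
import Summits.Ventures.LatticeQCDFlow.Scaling.WilsonIdentityFlowLaw
import Summits.Ventures.LatticeQCDFlow.Scoring.TorusAreaLaw2D
import Summits.Ventures.LatticeQCDFlow.TrivializingMaps.PlaquetteDecorrelation
import Summits.Ventures.LatticeQCDFlow.TrivializingMaps.SpecificHeatCeilingTwoDim

/-!
# LatticeQCDFlow / Scaling — THE TORUS, effective sample size and training loss: on the periodic
# `L × L` torus the untrained sampler's partition function, ESS and reverse loss are those of the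
# factorised `(L² − 1)`-plaquette sampler up to `e^{±2|β|N}`, `e^{±8|β|N}` and `±4|β|N`, for every
# compact gauge group, every `L ≥ 2` and every real coupling

HONEST FRAMING: exact (Metropolis-corrected) sampling algorithms for lattice gauge theory;
figures of merit are autocorrelation/cost numbers at stated couplings and volumes; no
continuum-physics claim.

Venture `LatticeQCDFlow` (cell pub-lqcd), topic `Scaling`; FANOUT row 3 (`s0-u1-a`, S0-B
implementation A: the 2-d flow sampler on the `16 × 16` torus, GEN-21).  NEW WORK of the cell, no
numerics, NO definition; sibling of `Scaling/TorusAcceptanceSandwich2D` (the acceptance).  Setting: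
theory-2's Wilson lattice gauge theory on `(ℤ/L)²` (`Literature…ConstructiveQFTWave0`), compact
second-countable `G`, continuous `N`-dimensional representation `ρ`, the UNTRAINED exact sampler
proposing Haar-distributed links against `e^{−βS}Haar^{⊗E}/Z_T(β)` (row 3's
`Scaling/WilsonIdentityFlowLaw`: `ESS = Z_T(β)²/Z_T(2β)`, reverse loss
`D(Haar^{⊗E} ‖ Wilson_β) = log Z_T(β) + β ∫ S dHaar^{⊗E}`).  Row 30's `Scaling/PlaquetteIndependence2D`
(`map_plaquettes_eq_pi`: off one puncture `x₀` the `L² − 1` plaquette holonomies are independent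
Haar variables under `Haar^{⊗E}`, `L ≥ 2`) and the bound `e^{±2|β|N}` on the punctured plaquette's
Boltzmann factor (`|Re tr ρ| ≤ N`, the tree's unitary trick) give, with
`z(β) = ∫ e^{β(Re tr ρ − N)} dHaar` the one-plaquette partition function and `m = ∫ Re tr ρ dHaar`:

* §1 **`torus_partitionFunction_sandwich`** — `e^{−2|β|N} z(β)^{L²−1} ≤ Z_T(β) ≤ e^{2|β|N} z(β)^{L²−1}`
  for EVERY real `β` (the tree's `partitionFunction_two_le` / `le_partitionFunction_two` of
  `Scaling/PlaquetteIndependence2D` are the `β ≥ 0`, `ℝ≥0∞` form with the sharper one-sided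
  constant; the limit theorems of the sibling need both signs, real form);
* §2 `sq_div_sandwich`, **`torus_essFrac_sandwich`** — the Kish fraction
  `ESS_T(β) = (∫p)²/∫p² = Z_T(β)²/Z_T(2β)` lies in `[e^{−8|β|N}, e^{8|β|N}] · (z(β)²/z(2β))^{L²−1}`,
  the factorised sampler's ESS (row 3's `Scaling/U1IdentityFlowVolumeLaw`, `SU2IdentityFlowVolumeLaw`,
  `WilsonIdentityFlowLaw`: per-plaquette rate `z(β)²/z(2β)`);
* §3 `integral_wilsonAction_haar_two` (`∫ S dHaar^{⊗E} = L²·(N − m)`: the action is the site sum —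
  `TrivializingMaps/SpecificHeatCeilingTwoDim.wilsonAction_two_eq_sum_sites`, reused — and every single
  plaquette is Haar distributed — `TrivializingMaps/PlaquetteDecorrelation`, reused),
  `abs_card_sub_haarMean_le`, **`torus_reverseKL_sandwich`** —
  `|D(Haar^{⊗E} ‖ Wilson_β) − (L² − 1)·ℓ(β)| ≤ 4|β|N` with the factorised sampler's per-plaquette
  reverse loss `ℓ(β) = log z(β) + β(N − m)` (`= cgf_{Re tr ρ − m}(β)`, GEN-20's
  `Scaling/TiltKLDivergence`).

Reading (value-free; no number of ours is computed or implied): the topological constraint of the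
two-dimensional torus costs the untrained sampler at most ONE plaquette's worth of partition
function, effective sample size and training loss, uniformly in the volume; in the coupling window
`β = Θ(1/L)` the factorised laws are the torus laws (sibling `Scaling/TorusDiagonalLimit2D`, staged
on this file's olean: `ESS_T → e^{−c²σ²}`, `D → c²σ²/2`, acceptance `→ erfc(|c|σ/2)` at
`β_L√(L² − 1) = c`).  NOT CLAIMED here: the limits; the forward loss; `d ≥ 3` (plaquettes are not
independent off a point there); trained flows; the sharp one-sided constants for `β ≥ 0`; any value
at the cell's `(β, L)`; nothing re-scored, SEALED.md untouched.
-/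

noncomputable section

namespace Summit.Ventures.LatticeQCDFlow.Theory2

open MeasureTheory Finset Real Set
open Literature.MathematicalPhysics.QuantumFieldTheory
open Lattice.TwoDim
variable {L N : ℕ} {G : Type*} [Group G] [TopologicalSpace G] [IsTopologicalGroup G]
  [CompactSpace G] [SecondCountableTopology G] [MeasurableSpace G] [BorelSpace G]
  (ρ : G →* Matrix (Fin N) (Fin N) ℂ)

/-! ## §1 The torus partition function versus `z(β)^{L² − 1}` -/

section PartitionFunction

omit [Group G] [TopologicalSpace G] [IsTopologicalGroup G] [CompactSpace G]
  [SecondCountableTopology G] [MeasurableSpace G] [BorelSpace G] in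
/-- `#{x ∈ (ℤ/L)² : x ≠ x₀} = L² − 1`. [folklore] -/
theorem card_site_ne [NeZero L] (x₀ : Site 2 L) :
    Fintype.card {x : Site 2 L // x ≠ x₀} = L ^ 2 - 1 := by
  rw [Fintype.card_subtype_compl, Fintype.card_subtype_eq, Fintype.card_fun, ZMod.card,
    Fintype.card_fin]

omit [SecondCountableTopology G] [MeasurableSpace G] [BorelSpace G] in
/-- The one-plaquette Boltzmann factor `e^{β(Re tr ρ(g) − N)}` lies in `[e^{−2|β|N}, e^{2|β|N}]`
(`|Re tr ρ| ≤ N`, the tree's unitary trick). [folklore] -/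
theorem oneplaquette_factor_mem_Icc (hρ : Continuous ρ) (β : ℝ) (g : G) :
    Real.exp (-(2 * |β| * N)) ≤ Real.exp (β * ((ρ g).trace.re - N)) ∧
      Real.exp (β * ((ρ g).trace.re - N)) ≤ Real.exp (2 * |β| * N) := by
  have h := Literature.RepresentationTheory.CompactGroups.CompactGroup.abs_re_trace_le_card ρ hρ g
  rw [Fintype.card_fin] at h
  have h2 : |(ρ g).trace.re - N| ≤ 2 * N := by
    have h1 := abs_le.1 h
    rw [abs_le]; constructor <;> linarith [h1.1, h1.2]
  have hb : |β * ((ρ g).trace.re - N)| ≤ 2 * |β| * N := by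
    rw [abs_mul, show 2 * |β| * (N : ℝ) = |β| * (2 * N) by ring]
    exact mul_le_mul_of_nonneg_left h2 (abs_nonneg _)
  exact ⟨Real.exp_le_exp.2 (abs_le.1 hb).1, Real.exp_le_exp.2 (abs_le.1 hb).2⟩

/-- **THE TORUS PARTITION FUNCTION SANDWICH** (all real `β`, `L ≥ 2`, every compact `G`):
`e^{−2|β|N}·z(β)^{L²−1} ≤ Z_T(β) = ∫ e^{−βS} dHaar^{⊗E} ≤ e^{2|β|N}·z(β)^{L²−1}`,
`z(β) = ∫ e^{β(Re tr ρ − N)} dHaar` — split off the plaquette at a puncture `x₀` and integrate the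
remaining `L² − 1` independent Haar plaquettes (row 30's `map_plaquettes_eq_pi`). [ours] -/
theorem torus_partitionFunction_sandwich [NeZero L] (hL : 2 ≤ L) (hρ : Continuous ρ) (β : ℝ) :
    Real.exp (-(2 * |β| * N)) *
        (∫ g, Real.exp (β * ((ρ g).trace.re - N)) ∂(haarProbability G)) ^ (L ^ 2 - 1) ≤
      ∫ U, Real.exp (-β * wilsonAction ρ U) ∂(Measure.pi fun _ : Edge 2 L => haarProbability G) ∧
    ∫ U, Real.exp (-β * wilsonAction ρ U) ∂(Measure.pi fun _ : Edge 2 L => haarProbability G) ≤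
      Real.exp (2 * |β| * N) *
        (∫ g, Real.exp (β * ((ρ g).trace.re - N)) ∂(haarProbability G)) ^ (L ^ 2 - 1) := by
  classical
  set x₀ : Site 2 L := 0 with hx₀
  set μE : Measure (GaugeConfig 2 L G) := Measure.pi fun _ : Edge 2 L => haarProbability G with hμE
  set μI : Measure ({x : Site 2 L // x ≠ x₀} → G) :=
    Measure.pi fun _ : {x : Site 2 L // x ≠ x₀} => haarProbability G with hμI
  set w : G → ℝ := fun g => Real.exp (β * ((ρ g).trace.re - N)) with hw
  set Φ : ({x : Site 2 L // x ≠ x₀} → G) → ℝ := fun y => ∏ x, w (y x) with hΦ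
  set plq : GaugeConfig 2 L G → ({x : Site 2 L // x ≠ x₀} → G) :=
    fun U x => plaquetteHolonomy U x.1 0 1 with hplq
  have hr : Continuous fun g : G => (ρ g).trace.re := Complex.continuous_re.comp hρ.matrix_trace
  have hwc : Continuous w := Real.continuous_exp.comp (continuous_const.mul (hr.sub continuous_const))
  have hΦc : Continuous Φ := continuous_finsetProd _ fun x _ => hwc.comp (continuous_apply x)
  have hplqm : Measurable plq :=
    measurable_pi_lambda _ fun x => measurable_plaquetteHolonomy (G := G) x.1
  have hw0 : ∀ g, 0 < w g := fun g => Real.exp_pos _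
  have hΦ0 : ∀ y, 0 ≤ Φ y := fun y => Finset.prod_nonneg fun x _ => (hw0 _).le
  -- the split `e^{−βS(U)} = w(U_{x₀}) · Φ(plq U)`
  have hsplit : ∀ U : GaugeConfig 2 L G,
      Real.exp (-β * wilsonAction ρ U) = w (plaquetteHolonomy U x₀ 0 1) * Φ (plq U) := by
    intro U
    have hform : ∀ g : G, Real.exp (-(β * ((N : ℝ) - (ρ g).trace.re))) = w g := fun g => by
      simp only [hw]; congr 1; ring
    rw [Scoring.exp_neg_mul_wilsonAction_two ρ β U]
    simp_rw [hform]
    rw [← Finset.mul_prod_erase _ _ (Finset.mem_univ x₀),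
      Finset.prod_subtype (Finset.univ.erase x₀) (p := fun x => x ≠ x₀) (fun x => by simp) _]
  -- the factorised partition function
  have hZF : ∫ U, Φ (plq U) ∂μE = (∫ g, w g ∂(haarProbability G)) ^ (L ^ 2 - 1) := by
    rw [hμE, ← integral_map hplqm.aemeasurable hΦc.aestronglyMeasurable, hplq,
      map_plaquettes_eq_pi hL x₀]
    simp only [hΦ]
    rw [integral_fintype_prod_eq_prod, Finset.prod_const, Finset.card_univ, card_site_ne]
  -- the sandwich
  have hPi : Integrable (fun U => Φ (plq U)) μE := by
    have hb : ∀ U, Φ (plq U) ≤ ∏ _x : {x : Site 2 L // x ≠ x₀}, Real.exp (2 * |β| * N) := fun U =>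
      Finset.prod_le_prod (fun x _ => (hw0 _).le)
        fun x _ => (oneplaquette_factor_mem_Icc ρ hρ β _).2
    exact Integrable.of_mem_Icc 0 _ (hΦc.measurable.comp hplqm).aemeasurable
      (ae_of_all _ fun U => ⟨hΦ0 _, hb U⟩)
  have hWi : Integrable (fun U : GaugeConfig 2 L G => Real.exp (-β * wilsonAction ρ U)) μE :=
    integrable_exp_mul_wilsonAction ρ hρ (-β) μE
  have hlo : ∀ U, Real.exp (-(2 * |β| * N)) * Φ (plq U) ≤ Real.exp (-β * wilsonAction ρ U) :=
    fun U => by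
      rw [hsplit U]
      exact mul_le_mul_of_nonneg_right (oneplaquette_factor_mem_Icc ρ hρ β _).1 (hΦ0 _)
  have hhi : ∀ U, Real.exp (-β * wilsonAction ρ U) ≤ Real.exp (2 * |β| * N) * Φ (plq U) :=
    fun U => by
      rw [hsplit U]
      exact mul_le_mul_of_nonneg_right (oneplaquette_factor_mem_Icc ρ hρ β _).2 (hΦ0 _)
  rw [← hZF]
  refine ⟨?_, ?_⟩
  · rw [← integral_const_mul]
    exact integral_mono (hPi.const_mul _) hWi hlo
  · rw [← integral_const_mul]
    exact integral_mono hWi (hPi.const_mul _) hhi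

omit [SecondCountableTopology G] in
/-- The one-plaquette partition function is positive. [folklore] -/
theorem oneplaquette_integral_pos (hρ : Continuous ρ) (β : ℝ) :
    0 < ∫ g, Real.exp (β * ((ρ g).trace.re - N)) ∂(haarProbability G) := by
  have hr : Continuous fun g : G => (ρ g).trace.re := Complex.continuous_re.comp hρ.matrix_trace
  refine integral_exp_pos (Integrable.of_mem_Icc (Real.exp (-(2 * |β| * N)))
    (Real.exp (2 * |β| * N)) ?_ (ae_of_all _ fun g => oneplaquette_factor_mem_Icc ρ hρ β g))
  exact (Real.continuous_exp.comp (continuous_const.mul (hr.sub continuous_const))).measurable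
    |>.aemeasurable

end PartitionFunction

/-! ## §2 The torus ESS versus the factorised ESS `(z(β)²/z(2β))^{L² − 1}` -/

section Ess

/-- Algebra of two partition-function sandwiches: `Z₁ ∈ [e^{−a}, e^{a}]·A`, `Z₂ ∈ [e^{−b}, e^{b}]·B`
(`A, B > 0`) give `Z₁²/Z₂ ∈ [e^{−(2a+b)}, e^{2a+b}]·A²/B`. [ours] -/
theorem sq_div_sandwich {Z₁ Z₂ A B a b : ℝ} (hA : 0 < A) (hB : 0 < B)
    (h1lo : Real.exp (-a) * A ≤ Z₁) (h1hi : Z₁ ≤ Real.exp a * A)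
    (h2lo : Real.exp (-b) * B ≤ Z₂) (h2hi : Z₂ ≤ Real.exp b * B) :
    Real.exp (-(2 * a + b)) * (A ^ 2 / B) ≤ Z₁ ^ 2 / Z₂ ∧
      Z₁ ^ 2 / Z₂ ≤ Real.exp (2 * a + b) * (A ^ 2 / B) := by
  have hZ1 : 0 ≤ Z₁ := (mul_nonneg (Real.exp_pos _).le hA.le).trans h1lo
  have hZ2 : 0 < Z₂ := lt_of_lt_of_le (mul_pos (Real.exp_pos _) hB) h2lo
  have hsqlo : (Real.exp (-a) * A) ^ 2 ≤ Z₁ ^ 2 :=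
    pow_le_pow_left₀ (mul_nonneg (Real.exp_pos _).le hA.le) h1lo 2
  have hsqhi : Z₁ ^ 2 ≤ (Real.exp a * A) ^ 2 := pow_le_pow_left₀ hZ1 h1hi 2
  have e1 : Real.exp (-(2 * a + b)) * (A ^ 2 / B) = (Real.exp (-a) * A) ^ 2 / (Real.exp b * B) := by
    rw [show -(2 * a + b) = -a + -a - b by ring, Real.exp_sub, Real.exp_add]
    field_simp
  have e2 : Real.exp (2 * a + b) * (A ^ 2 / B) = (Real.exp a * A) ^ 2 / (Real.exp (-b) * B) := by
    rw [show (2 * a + b) = a + a - -b by ring, Real.exp_sub, Real.exp_add]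
    field_simp
  refine ⟨?_, ?_⟩
  · rw [e1]
    exact div_le_div₀ (sq_nonneg _) hsqlo hZ2 h2hi
  · rw [e2]
    exact div_le_div₀ (sq_nonneg _) hsqhi (mul_pos (Real.exp_pos _) hB) h2lo

/-- **THE TORUS ESS SANDWICH**: for every real `β`, `L ≥ 2` and every compact `G`, the Kish
effective-sample-size fraction `(∫ p)²/∫ p²` (`p = e^{−βS}/Z_T(β)`, Haar reference law) of the
untrained exact sampler on `(ℤ/L)²` lies in `[e^{−8|β|N}, e^{8|β|N}] · (z(β)²/z(2β))^{L²−1}` — the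
factorised sampler's ESS up to a volume-independent factor. [ours] -/
theorem torus_essFrac_sandwich [NeZero L] (hL : 2 ≤ L) (hρ : Continuous ρ) (β : ℝ) :
    Real.exp (-(8 * |β| * N)) *
        ((∫ g, Real.exp (β * ((ρ g).trace.re - N)) ∂(haarProbability G)) ^ 2 /
            ∫ g, Real.exp (2 * β * ((ρ g).trace.re - N)) ∂(haarProbability G)) ^ (L ^ 2 - 1) ≤
      (∫ U, Real.exp (-β * wilsonAction ρ U) / ∫ V, Real.exp (-β * wilsonAction ρ V)
            ∂(Measure.pi fun _ : Edge 2 L => haarProbability G)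
          ∂(Measure.pi fun _ : Edge 2 L => haarProbability G)) ^ 2 /
        ∫ U, (Real.exp (-β * wilsonAction ρ U) / ∫ V, Real.exp (-β * wilsonAction ρ V)
            ∂(Measure.pi fun _ : Edge 2 L => haarProbability G)) ^ 2
          ∂(Measure.pi fun _ : Edge 2 L => haarProbability G) ∧
    (∫ U, Real.exp (-β * wilsonAction ρ U) / ∫ V, Real.exp (-β * wilsonAction ρ V)
            ∂(Measure.pi fun _ : Edge 2 L => haarProbability G)
          ∂(Measure.pi fun _ : Edge 2 L => haarProbability G)) ^ 2 /
        ∫ U, (Real.exp (-β * wilsonAction ρ U) / ∫ V, Real.exp (-β * wilsonAction ρ V)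
            ∂(Measure.pi fun _ : Edge 2 L => haarProbability G)) ^ 2
          ∂(Measure.pi fun _ : Edge 2 L => haarProbability G) ≤
      Real.exp (8 * |β| * N) *
        ((∫ g, Real.exp (β * ((ρ g).trace.re - N)) ∂(haarProbability G)) ^ 2 /
            ∫ g, Real.exp (2 * β * ((ρ g).trace.re - N)) ∂(haarProbability G)) ^ (L ^ 2 - 1) := by
  rw [wilsonIdentityFlow_essFrac ρ _ hρ β]
  have h1 := torus_partitionFunction_sandwich ρ hL hρ β
  have h2 := torus_partitionFunction_sandwich ρ hL hρ (2 * β)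
  have hA := oneplaquette_integral_pos ρ hρ β
  have hB := oneplaquette_integral_pos ρ hρ (2 * β)
  have hab : 2 * (2 * |β| * N) + 2 * |2 * β| * N = 8 * |β| * N := by
    rw [abs_mul, abs_two]; ring
  have h := sq_div_sandwich (pow_pos hA _) (pow_pos hB _) h1.1 h1.2 h2.1 h2.2
  rw [hab, ← pow_mul, mul_comm (L ^ 2 - 1) 2, pow_mul, ← div_pow] at h
  exact h

end Ess

/-! ## §3 The torus reverse loss versus `(L² − 1)·ℓ(β)` -/

section Loss

/-- **Every plaquette of the torus is Haar distributed** under product Haar on the links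
(`TrivializingMaps/PlaquetteDecorrelation`, any `d`), so on `(ℤ/L)²`, `L ≥ 2`:
`∫ S dHaar^{⊗E} = L²·(N − m)`, `m = ∫ Re tr ρ dHaar`. [ours] -/
theorem integral_wilsonAction_haar_two [NeZero L] (hL : 2 ≤ L) (hρ : Continuous ρ) :
    ∫ U, wilsonAction ρ U ∂(Measure.pi fun _ : Edge 2 L => haarProbability G) =
      (L : ℝ) ^ 2 * (N - ∫ g, (ρ g).trace.re ∂(haarProbability G)) := by
  have hr : Continuous fun g : G => (ρ g).trace.re := Complex.continuous_re.comp hρ.matrix_trace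
  have hri : Integrable (fun g : G => (ρ g).trace.re) (haarProbability G) := by
    refine Integrable.of_mem_Icc (-(N : ℝ)) N hr.measurable.aemeasurable (ae_of_all _ fun g => ?_)
    have h := Literature.RepresentationTheory.CompactGroups.CompactGroup.abs_re_trace_le_card ρ hρ g
    rw [Fintype.card_fin] at h
    exact abs_le.1 h
  have h1 : ∀ x : Site 2 L, ∫ U, ((N : ℝ) - (ρ (plaquetteHolonomy U x 0 1)).trace.re)
      ∂(Measure.pi fun _ : Edge 2 L => haarProbability G) = N - ∫ g, (ρ g).trace.re ∂(haarProbability G) := by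
    intro x
    have h := TrivializingMaps.integral_comp_plaquetteHolonomy_eq_haar_group (G := G) (d := 2) hL x
      (i := 0) (j := 1) (by decide) (φ := fun g => (N : ℝ) - (ρ g).trace.re) (continuous_const.sub hr)
    rw [show Luscher2010.trivialMeasure G 2 L = Measure.pi fun _ : Edge 2 L => haarProbability G
      from rfl] at h
    rw [h, integral_sub (integrable_const _) hri, integral_const, probReal_univ, one_smul]
  have hterm : ∀ x : Site 2 L, Integrable (fun U : GaugeConfig 2 L G =>
      (N : ℝ) - (ρ (plaquetteHolonomy U x 0 1)).trace.re)
      (Measure.pi fun _ : Edge 2 L => haarProbability G) := fun x => by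
    refine Integrable.of_mem_Icc (0 : ℝ) (2 * N)
      (measurable_const.sub (hr.measurable.comp (measurable_plaquetteHolonomy x))).aemeasurable
      (ae_of_all _ fun U => ?_)
    have h := Literature.RepresentationTheory.CompactGroups.CompactGroup.abs_re_trace_le_card ρ hρ
      (plaquetteHolonomy U x 0 1)
    rw [Fintype.card_fin] at h
    have h' := abs_le.1 h
    exact ⟨by linarith [h'.2], by linarith [h'.1]⟩
  simp_rw [TrivializingMaps.wilsonAction_two_eq_sum_sites ρ]
  rw [integral_finsetSum _ fun x _ => hterm x, Finset.sum_congr rfl fun x _ => h1 x, Finset.sum_const,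
    Finset.card_univ, Fintype.card_fun, ZMod.card, Fintype.card_fin, nsmul_eq_mul]
  push_cast
  ring

omit [SecondCountableTopology G] [MeasurableSpace G] [BorelSpace G] in
/-- `|N − m| ≤ 2N` for the Haar mean `m` of `Re tr ρ` (indeed `|m| ≤ N`). [folklore] -/
theorem abs_card_sub_haarMean_le [MeasurableSpace G] [BorelSpace G] (hρ : Continuous ρ) :
    |(N : ℝ) - ∫ g, (ρ g).trace.re ∂(haarProbability G)| ≤ 2 * N := by
  have hm : |∫ g, (ρ g).trace.re ∂(haarProbability G)| ≤ N := by
    refine (abs_integral_le_integral_abs).trans ?_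
    calc ∫ g, |(ρ g).trace.re| ∂(haarProbability G) ≤ ∫ _g, (N : ℝ) ∂(haarProbability G) :=
          integral_mono_of_nonneg (ae_of_all _ fun g => abs_nonneg _) (integrable_const _)
            (ae_of_all _ fun g => by
              have h := Literature.RepresentationTheory.CompactGroups.CompactGroup.abs_re_trace_le_card
                ρ hρ g
              rw [Fintype.card_fin] at h
              exact h)
      _ = N := by rw [integral_const, probReal_univ, one_smul]
  have h := abs_le.1 hm
  rw [abs_le]; constructor <;> nlinarith [h.1, h.2, Nat.cast_nonneg (α := ℝ) N]

/-- **THE TORUS REVERSE-LOSS SANDWICH**: for every real `β`, `L ≥ 2` and every compact `G`, the reverse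
Kullback–Leibler divergence `D(Haar^{⊗E} ‖ Wilson_β) = ∫ log(1/p) dHaar^{⊗E}` of the untrained sampler
on `(ℤ/L)²` differs from `(L² − 1)·ℓ(β)`, `ℓ(β) = log z(β) + β(N − m)` the factorised sampler's
per-plaquette reverse loss, by at most `4|β|N`. [ours] -/
theorem torus_reverseKL_sandwich [NeZero L] (hL : 2 ≤ L) (hρ : Continuous ρ) (β : ℝ) :
    |∫ U, Real.log (1 / (Real.exp (-β * wilsonAction ρ U) /
          ∫ V, Real.exp (-β * wilsonAction ρ V) ∂(Measure.pi fun _ : Edge 2 L => haarProbability G)))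
          ∂(Measure.pi fun _ : Edge 2 L => haarProbability G) -
        ((L ^ 2 - 1 : ℕ) : ℝ) *
          (Real.log (∫ g, Real.exp (β * ((ρ g).trace.re - N)) ∂(haarProbability G)) +
            β * (N - ∫ g, (ρ g).trace.re ∂(haarProbability G)))| ≤ 4 * |β| * N := by
  rw [wilsonIdentityFlow_reverseKL ρ _ hρ β, integral_wilsonAction_haar_two ρ hL hρ]
  set Z : ℝ := ∫ V, Real.exp (-β * wilsonAction ρ V)
    ∂(Measure.pi fun _ : Edge 2 L => haarProbability G) with hZ
  set z : ℝ := ∫ g, Real.exp (β * ((ρ g).trace.re - N)) ∂(haarProbability G) with hz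
  set m : ℝ := ∫ g, (ρ g).trace.re ∂(haarProbability G) with hm
  have hsw := torus_partitionFunction_sandwich ρ hL hρ β
  have hzpos : 0 < z := oneplaquette_integral_pos ρ hρ β
  have hzn : 0 < z ^ (L ^ 2 - 1) := pow_pos hzpos _
  have hZpos : 0 < Z := lt_of_lt_of_le (mul_pos (Real.exp_pos _) hzn) hsw.1
  -- `|log Z − (L² − 1) log z| ≤ 2|β|N`
  have hlog : |Real.log Z - ((L ^ 2 - 1 : ℕ) : ℝ) * Real.log z| ≤ 2 * |β| * N := by
    rw [← Real.log_pow, ← Real.log_div hZpos.ne' hzn.ne', abs_le]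
    constructor
    · rw [← Real.log_exp (-(2 * |β| * N))]
      exact Real.log_le_log (Real.exp_pos _) ((le_div_iff₀ hzn).2 hsw.1)
    · rw [← Real.log_exp (2 * |β| * N)]
      exact Real.log_le_log (div_pos hZpos hzn) ((div_le_iff₀ hzn).2 hsw.2)
  have hL2 : ((L : ℝ)) ^ 2 = ((L ^ 2 - 1 : ℕ) : ℝ) + 1 := by
    have h1 : 1 ≤ L ^ 2 := Nat.one_le_pow _ _ (Nat.pos_of_ne_zero (NeZero.ne L))
    rw [Nat.cast_sub h1]; push_cast; ring
  have hβm : |β * ((N : ℝ) - m)| ≤ 2 * |β| * N := by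
    rw [abs_mul, show 2 * |β| * (N : ℝ) = |β| * (2 * N) by ring]
    exact mul_le_mul_of_nonneg_left (abs_card_sub_haarMean_le ρ hρ) (abs_nonneg _)
  have e : Real.log Z + β * ((L : ℝ) ^ 2 * (N - m)) - ((L ^ 2 - 1 : ℕ) : ℝ) * (Real.log z + β * (N - m))
      = (Real.log Z - ((L ^ 2 - 1 : ℕ) : ℝ) * Real.log z) + β * (N - m) := by
    rw [hL2]; ring
  rw [e]
  refine (abs_add_le _ _).trans ?_
  linarith [hlog, hβm]

end Loss


end Summit.Ventures.LatticeQCDFlow.Theory2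

end
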